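import Summits.QuantumFields.YangMills.Theorems.BalabanUVNodesN18TwoRunLettersCalculusResolvent

/-!
# BalabanUVNodes ∕ N18 — THE TWO-RUN CLOSENESS-LETTER CALCULUS, PART 4 (SQUARE ROOT, SECOND ORDER): the σ-LOCALISED two-run
# closeness letter (C2) of `N18TwoRunLetters.termWalkData_of_staticLetters_at_window` for the SQUARE-ROOT factor `σ ↦ (P(σ))^{−1/2}`
# ([Balaban1988RG2Cluster] (2.7) p. 13: `(C^{(k)})^{1/2} = (C*Δ_kC)^{−1/2} = (1/π)∫₀^∞ dx x^{−1/2}(xI + C*Δ_kC)^{−1}`) — the second-order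
# resolvent expansion INSIDE the `x^{−1/2}` integral; companion of parts 1–3 (`…Calculus`, `…CalculusResolvent` §5 `close_invSqrt` = (C1) of the
# square root, `…CalculusInvLoc`) (Track A, DAG node N18 = NE5 `T4OutputRate.NE5 EA EB W κ θ C₅`; cluster K4 «SpineRates»)

Cell `pub-ymgap`, HUMAN RULING D-0149 (T⁴ apex work-bound push), width seat `pub-ymgap-dag-n18-w1` (g0); W-SEAT-START-LIST v3 §2 n18 item 1
(«`N18At` at the record … start from `…N18EndLetters` ∕ `…N18TwoRunLetters` currency»), SUB-LEMMA «two-run closeness-letter calculus», part 4.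
`--kind proof --supports stmt-QuantumFields-20544` (K3⁷ `SpineGivenEndpointR13SepCoPH`) as a HELPER — COUNT-NEUTRAL.

HONEST FRAMING.  Finite-matrix bookkeeping; THEOREMS ONLY, 0 `def`, 0 `sorry`, standard axioms.  Every letter is a HYPOTHESIS about abstract
static precision families `σ ↦ A(σ)` ∕ `σ ↦ P(σ)`; nothing of Bałaban's `Γ_k`, `Δ^{(k)}(Z₀,σ,𝐔,𝐉)`, `C^{(k)}`, `(C^{(k)})^{1/2}` is constructed or asserted;
the PRIMITIVE two-run closeness letters (rows NE2∕NE3's η-rate for Bałaban's propagators at two lattice spacings; NODE O 0∕1) are NOT supplied; NE5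
NOT IN PRINT ([Balaban1987RG1] Thm 1 p. 259) and NOT PROVED; N18 NOT discharged; counts UNMOVED (typed 28∕28 · discharged 5∕27); one finite
four-torus programme at fixed ε — NOT continuum, NOT ℝ⁴, NOT OS, NOT a mass gap, NOT Clay.
A6 ∕ SATISFIABILITY (№189).  The displayed hypotheses of every theorem below are JOINTLY SATISFIABLE — e.g. identical runs (`K_A = K_B`, `A_A = A_B`,
`P_A = P_B`, rate `ϱ = 0`) with constant-in-σ families, the precision `P(σ) := m·1` (range one, `m`-accretive, off-diagonal sums `0`), any `X ≠ ∅` — so no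
statement is vacuous; they carry CONTENT only when instantiated at Bałaban's primitives with rows NE2∕NE3's rate, which this file does not do.

WHAT (binder shapes = `N18TwoRunLetters` §3∕§4):
* `resolvent_second_order` (plumbing) — from the four first-order resolvent identities, `(R₁ − R₂) − (R₃ − R₄) = R₁(T₃ − T₁)R₃(T₂ − T₁)R₂ +
  R₃((T₂ − T₁) − (T₄ − T₃))R₂ + R₃(T₄ − T₃)(R₂(T₄ − T₂)R₄)` — ONE differenced line per term.
* §8 ★ `locClose_invSqrt` — (C2) of `σ ↦ (P(σ))^{−1/2}` for static `m`-accretive range-one precision families `P_A, P_B` (off-diagonal sums `≤ h`,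
  `h(e^θ − 1) ≤ m∕2`, located bonds `d₁(loc i, loc j) ≤ s·dist i j`) from the σ-localisation (L2) of BOTH runs (amplitude `B₀`, through `X ≠ ∅`), the two-run
  (C1) (`B_E`, in `d₁`) and (C2) (`D_E′`, through `X`) at rate `ϱ`, all at decay `ρ` with `ρ·s ≤ θ` (the four resolvent families `(x + P_B(σ))⁻¹`,
  `(x + P_B(0))⁻¹`, `(x + P_A(σ))⁻¹`, `(x + P_A(0))⁻¹` then decay at rate `ρ` in `d₁`-currency, uniformly in `x ≥ 0`: `B13Sqrt27Accretive.resolvent_decay`),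
  and `d₁`-currency volume sums `c_V` at margin `η`: amplitude `16B_EB₀c_V⁴∕(m²√m) + 4D_E′c_V²∕(m√m)`, decay `ρ′` through `X` with `ρ′ + 4η ≤ ρ`.  Proof:
  (2.7) entrywise (`invSqrt_apply`), `resolvent_second_order` under the integral — two 5-fold products (ONE two-run-differenced precision and ONE σ-localised
  precision between three resolvents) and one 3-fold product (the precision's own (C2) between two resolvents), part 1 §1 four ∕ two times per term,
  `(2∕(m+x))³ ≤ (2∕(m+x))(2∕m)²`, `(1∕π)∫₀^∞ x^{−1/2}(m+x)⁻¹dx = 1∕√m` (`B13Sqrt27.integral_kernel_Ioi`).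
With parts 1–3 the calculus now yields BOTH Γ-slot binders `hcloseΓ` (part 2 §6 `close_mul_invSqrt`) and `hlocΓ` (part 1 `locClose_mul` ∘ this file ∘
`NodeOLettersSqrt.kernelLetters_invSqrt`'s (L1)∕(L2)) of the END for a Γ-kernel of the shape «local factor × (precision)^{−1/2}» ([II] p. 13) from the
letters of its PRIMITIVES — which remain rows NE2∕NE3's ∕ NODE O's content.
NOT COVERED (honest): letters for Bałaban's actual primitives; the END's other binders; the assembled `hlocΓ` plug (one `locClose_mul` call; left to the
consumer to keep this file under the 400-line rule).

Sources (mechanism and shapes only; nothing printed is asserted): T. Bałaban, CMP **116** (1988) [Balaban1988RG2Cluster] (1.11) p. 5, (2.7) p. 13, p. 15,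
(2.16) p. 16; CMP **99** (1985) [Balaban1985BackgroundPropagators] (3.93) p. 410, Thm 3.10 p. 416; C. King, CMP **102** (1986) [King1986] p. 665.
Nothing here is a claim about the Yang–Mills mass gap.
-/

noncomputable section

namespace Summit.QuantumFields.YangMills.BalabanUVNodes.N18TwoRunLettersCalculusSqrtLoc

open Metric Set Finset MeasureTheory
open scoped Matrix
open Literature.MathematicalPhysics.QuantumFieldTheory.Balaban1983to89
open Literature.MathematicalPhysics.QuantumFieldTheory.Balaban1983to89.B9Thm37GlueTorus (tdist1 tdist1_nonneg)
open Literature.MathematicalPhysics.QuantumFieldTheory.Balaban1983to89.TreeLengthTorus (TPt)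
open Literature.MathematicalPhysics.QuantumFieldTheory.Balaban1983to89.B5TorusCover (UT)
open Literature.MathematicalPhysics.QuantumFieldTheory.Balaban1983to89.NodeOLetters (distX distX_nonneg)
open Literature.MathematicalPhysics.QuantumFieldTheory.Balaban1983to89.B13Sqrt27Accretive
  (invSqrt invSqrt_apply resolvent_decay integrableOn_integrand)
open Literature.MathematicalPhysics.QuantumFieldTheory.Balaban1983to89.B13Sqrt27 (kernel integral_kernel_Ioi integrableOn_kernel_Ioi)
open Summit.QuantumFields.YangMills.BalabanUVNodes.N18TwoRunLettersCalculus
  (norm_mul_apply_le_of_decay norm_mul_apply_le_of_decayX_left norm_mul_apply_le_of_decayX_right)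

variable {d N' : ℕ} {ν : ℕ} {Nf : Fin ν → ℕ} [∀ i, NeZero (Nf i)]

omit [∀ i, NeZero (Nf i)] in
/-- `σ = 0` lies in the polydisc `‖σ_j‖ ≤ e^{κ₁}` (plumbing). [folklore] -/
private theorem zero_mem_polydisc' (c : B13.Consts) : ∀ j, ‖(0 : TPt d N' → ℂ) j‖ ≤ Real.exp c.κ₁ :=
  fun _ => by simpa using (Real.exp_pos c.κ₁).le

/-! ## §8 SQUARE ROOT, SECOND ORDER: (C2) of `σ ↦ (P(σ))^{−1/2}` — the second-order resolvent expansion inside the `x^{−1/2}` integral of (2.7) -/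

section SqrtLoc

variable {Λ : Type} [Fintype Λ] [DecidableEq Λ] {c : B13.Consts}

omit [DecidableEq Λ] [∀ i, NeZero (Nf i)] in
/-- **The second-order resolvent identity** (plumbing): from the four first-order identities `R₁ − R₂ = R₁(T₂ − T₁)R₂`, `R₃ − R₄ = R₃(T₄ − T₃)R₄`,
`R₁ − R₃ = R₁(T₃ − T₁)R₃`, `R₂ − R₄ = R₂(T₄ − T₂)R₄`:
`(R₁ − R₂) − (R₃ − R₄) = R₁(T₃ − T₁)R₃(T₂ − T₁)R₂ + R₃((T₂ − T₁) − (T₄ − T₃))R₂ + R₃(T₄ − T₃)(R₂(T₄ − T₂)R₄)` — ONE differenced line per term.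
[cite: Balaban1988RG2Cluster, (2.7) p.13, (2.16) p.16; King1986, p.665] -/
theorem resolvent_second_order {R₁ R₂ R₃ R₄ T₁ T₂ T₃ T₄ : Matrix Λ Λ ℂ}
    (h12 : R₁ - R₂ = R₁ * (T₂ - T₁) * R₂) (h34 : R₃ - R₄ = R₃ * (T₄ - T₃) * R₄)
    (h13 : R₁ - R₃ = R₁ * (T₃ - T₁) * R₃) (h24 : R₂ - R₄ = R₂ * (T₄ - T₂) * R₄) :
    (R₁ - R₂) - (R₃ - R₄) =
      R₁ * (T₃ - T₁) * R₃ * (T₂ - T₁) * R₂ + R₃ * ((T₂ - T₁) - (T₄ - T₃)) * R₂ + R₃ * (T₄ - T₃) * (R₂ * (T₄ - T₂) * R₄) := by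
  have e1 : R₁ * (T₂ - T₁) * R₂ - R₃ * (T₄ - T₃) * R₄ =
      (R₁ - R₃) * (T₂ - T₁) * R₂ + R₃ * ((T₂ - T₁) - (T₄ - T₃)) * R₂ + R₃ * (T₄ - T₃) * (R₂ - R₄) := by
    simp only [Matrix.sub_mul, Matrix.mul_sub]; abel
  rw [h12, h34, e1, h13, h24]

/-- **(C2) OF THE SQUARE-ROOT FACTOR `σ ↦ (P(σ))^{−1/2}`** — the second-order companion of `close_invSqrt` (and of the one-run (L2) letter
`NodeOLettersSqrt.kernelLetters_invSqrt`): for static `m`-accretive range-one precision families `P_A, P_B : Λ × Λ` on the polydisc (off-diagonal sums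
`≤ h`, `h(e^θ − 1) ≤ m∕2`, bonds located by `locΛ` with `d₁(loc i, loc j) ≤ s·dist i j`), with the σ-localisation letter (L2) of BOTH runs
(amplitude `B₀`, through `X ≠ ∅`), the two-run letters (C1) (amplitude `B_E`, in `d₁`) and (C2) (amplitude `D_E′`, through `X`) at rate `ϱ ≥ 0`, all at
decay `ρ` with `ρ·s ≤ θ` (so the resolvents `(x + P)⁻¹` decay at rate `ρ` in `d₁`-currency, `resolvent_decay`), and `d₁`-currency volume sums `c_V`
at margin `η` ⟹ the σ-LOCALISED two-run difference of the square roots obeys (C2) at rate `ϱ`, amplitude `16B_EB₀c_V⁴∕(m²√m) + 4D_E′c_V²∕(m√m)`,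
decay `ρ′` through `X` (`ρ′ + 4η ≤ ρ`).  Proof: (2.7) entrywise, `resolvent_second_order` under the integral (two 5-fold products with ONE two-run
differenced precision and ONE σ-localised precision between resolvents, one 3-fold product with the precision's own (C2) in the middle), part 1 §1 for the
products, `(2∕(m+x))³ ≤ (2∕(m+x))(2∕m)²`, and `(1∕π)∫₀^∞ x^{−1/2}(m+x)⁻¹dx = 1∕√m` (`B13Sqrt27.integral_kernel_Ioi`).
[cite: Balaban1988RG2Cluster, (2.7) p.13, p.15, (2.16) p.16; Balaban1985BackgroundPropagators, (3.93) p.410, Thm 3.10 p.416; King1986, p.665] -/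
theorem locClose_invSqrt (locΛ : Λ → UT Nf) (PA PB : (TPt d N' → ℂ) → Matrix Λ Λ ℂ)
    (dist : Λ → Λ → ℕ) (hd0 : ∀ i, dist i i = 0) (hds : ∀ i j, dist i j = dist j i)
    (hdt : ∀ i j k, dist i k ≤ dist i j + dist j k)
    {s : ℝ} (hloc : ∀ i j, tdist1 Nf (locΛ i) (locΛ j) ≤ s * dist i j) {X : Finset (UT Nf)} (hX : X.Nonempty)
    {h m θ η cV BE B₀ DE' ρ ρ' ϱ : ℝ} (hm : 0 < m) (hθ : 0 ≤ θ) (hhθ : h * (Real.exp θ - 1) ≤ m / 2)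
    (hBE : 0 ≤ BE) (hB₀ : 0 ≤ B₀) (hDE' : 0 ≤ DE') (hϱ : 0 ≤ ϱ) (hρθ : ρ * s ≤ θ)
    (hρ' : 0 ≤ ρ') (hη : 0 ≤ η) (hsplit : ρ' + 4 * η ≤ ρ)
    (hrangeA : ∀ σ : TPt d N' → ℂ, (∀ j, ‖σ j‖ ≤ Real.exp c.κ₁) → ∀ i j, PA σ i j ≠ 0 → dist i j ≤ 1)
    (hrangeB : ∀ σ : TPt d N' → ℂ, (∀ j, ‖σ j‖ ≤ Real.exp c.κ₁) → ∀ i j, PB σ i j ≠ 0 → dist i j ≤ 1)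
    (hrowA : ∀ σ : TPt d N' → ℂ, (∀ j, ‖σ j‖ ≤ Real.exp c.κ₁) → ∀ i, ∑ j ∈ univ.filter (fun j => dist i j ≠ 0), ‖PA σ i j‖ ≤ h)
    (hcolA : ∀ σ : TPt d N' → ℂ, (∀ j, ‖σ j‖ ≤ Real.exp c.κ₁) → ∀ j, ∑ i ∈ univ.filter (fun i => dist i j ≠ 0), ‖PA σ i j‖ ≤ h)
    (hrowB : ∀ σ : TPt d N' → ℂ, (∀ j, ‖σ j‖ ≤ Real.exp c.κ₁) → ∀ i, ∑ j ∈ univ.filter (fun j => dist i j ≠ 0), ‖PB σ i j‖ ≤ h)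
    (hcolB : ∀ σ : TPt d N' → ℂ, (∀ j, ‖σ j‖ ≤ Real.exp c.κ₁) → ∀ j, ∑ i ∈ univ.filter (fun i => dist i j ≠ 0), ‖PB σ i j‖ ≤ h)
    (haccA : ∀ σ : TPt d N' → ℂ, (∀ j, ‖σ j‖ ≤ Real.exp c.κ₁) →
      ∀ v : Λ → ℂ, m * ∑ i, ‖v i‖ ^ 2 ≤ (∑ i, star (v i) * (PA σ *ᵥ v) i).re)
    (haccB : ∀ σ : TPt d N' → ℂ, (∀ j, ‖σ j‖ ≤ Real.exp c.κ₁) →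
      ∀ v : Λ → ℂ, m * ∑ i, ‖v i‖ ^ 2 ≤ (∑ i, star (v i) * (PB σ *ᵥ v) i).re)
    (hA' : ∀ σ : TPt d N' → ℂ, (∀ j, ‖σ j‖ ≤ Real.exp c.κ₁) →
      ∀ k l, ‖PA σ k l - PA 0 k l‖ ≤ B₀ * Real.exp (-(ρ * distX X (locΛ k) (locΛ l))))
    (hB' : ∀ σ : TPt d N' → ℂ, (∀ j, ‖σ j‖ ≤ Real.exp c.κ₁) →
      ∀ k l, ‖PB σ k l - PB 0 k l‖ ≤ B₀ * Real.exp (-(ρ * distX X (locΛ k) (locΛ l))))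
    (hclose : ∀ σ : TPt d N' → ℂ, (∀ j, ‖σ j‖ ≤ Real.exp c.κ₁) →
      ∀ k l, ‖PB σ k l - PA σ k l‖ ≤ ϱ * (BE * Real.exp (-(ρ * tdist1 Nf (locΛ k) (locΛ l)))))
    (hlocP : ∀ σ : TPt d N' → ℂ, (∀ j, ‖σ j‖ ≤ Real.exp c.κ₁) →
      ∀ k l, ‖(PB σ k l - PB 0 k l) - (PA σ k l - PA 0 k l)‖ ≤ ϱ * (DE' * Real.exp (-(ρ * distX X (locΛ k) (locΛ l)))))
    (hvol : ∀ i, ∑ k, Real.exp (-(η * tdist1 Nf (locΛ i) (locΛ k))) ≤ cV)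
    (hvol' : ∀ j, ∑ k, Real.exp (-(η * tdist1 Nf (locΛ k) (locΛ j))) ≤ cV) :
    ∀ σ : TPt d N' → ℂ, (∀ j, ‖σ j‖ ≤ Real.exp c.κ₁) →
      ∀ i j, ‖(invSqrt (PB σ) i j - invSqrt (PB 0) i j) - (invSqrt (PA σ) i j - invSqrt (PA 0) i j)‖
        ≤ ϱ * ((16 * BE * B₀ * cV ^ 4 / (m ^ 2 * Real.sqrt m) + 4 * DE' * cV ^ 2 / (m * Real.sqrt m)) *
            Real.exp (-(ρ' * distX X (locΛ i) (locΛ j)))) := by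
  intro σ hσ i j
  have h0 := zero_mem_polydisc' (d := d) (N' := N') c
  have hcV : 0 ≤ cV := (Finset.sum_nonneg fun k _ => (Real.exp_pos _).le).trans (hvol i)
  -- the four resolvent families of (T₁, T₂, T₃, T₄) = (P_B(σ), P_B(0), P_A(σ), P_A(0))
  have hR1 := fun (x : ℝ) (hx : 0 ≤ x) =>
    resolvent_decay dist hd0 hds hdt (PB σ) (hrangeB σ hσ) h (hrowB σ hσ) (hcolB σ hσ) m θ hm hθ (haccB σ hσ) hhθ hx
  have hR2 := fun (x : ℝ) (hx : 0 ≤ x) =>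
    resolvent_decay dist hd0 hds hdt (PB 0) (hrangeB 0 h0) h (hrowB 0 h0) (hcolB 0 h0) m θ hm hθ (haccB 0 h0) hhθ hx
  have hR3 := fun (x : ℝ) (hx : 0 ≤ x) =>
    resolvent_decay dist hd0 hds hdt (PA σ) (hrangeA σ hσ) h (hrowA σ hσ) (hcolA σ hσ) m θ hm hθ (haccA σ hσ) hhθ hx
  have hR4 := fun (x : ℝ) (hx : 0 ≤ x) =>
    resolvent_decay dist hd0 hds hdt (PA 0) (hrangeA 0 h0) h (hrowA 0 h0) (hcolA 0 h0) m θ hm hθ (haccA 0 h0) hhθ hx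
  have hI1 := integrableOn_integrand (PB σ) hm (haccB σ hσ) i j
  have hI2 := integrableOn_integrand (PB 0) hm (haccB 0 h0) i j
  have hI3 := integrableOn_integrand (PA σ) hm (haccA σ hσ) i j
  have hI4 := integrableOn_integrand (PA 0) hm (haccA 0 h0) i j
  -- rates: the letters sit at `ρ`; resolvents decay at rate `ρ` in `d₁`-currency because `ρ·d₁(loc k, loc l) ≤ ρ·s·dist ≤ θ·dist`
  have hρ0 : 0 ≤ ρ := by linarith
  have hrate : ∀ k l, ρ * tdist1 Nf (locΛ k) (locΛ l) ≤ θ * (dist k l : ℝ) := by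
    intro k l
    have hdkl : (0 : ℝ) ≤ dist k l := Nat.cast_nonneg _
    calc ρ * tdist1 Nf (locΛ k) (locΛ l) ≤ ρ * (s * dist k l) := mul_le_mul_of_nonneg_left (hloc k l) hρ0
      _ = (ρ * s) * dist k l := by ring
      _ ≤ θ * dist k l := mul_le_mul_of_nonneg_right hρθ hdkl
  -- weakening of majorants in the rate
  have wk : ∀ {M : Matrix Λ Λ ℂ} {amp r r' : ℝ} {w : Λ → Λ → ℝ}, 0 ≤ amp → r' ≤ r → (∀ k l, 0 ≤ w k l) →
      (∀ k l, ‖M k l‖ ≤ amp * Real.exp (-(r * w k l))) → ∀ k l, ‖M k l‖ ≤ amp * Real.exp (-(r' * w k l)) :=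
    fun hamp hrr hw hM k l => (hM k l).trans
      (mul_le_mul_of_nonneg_left (Real.exp_le_exp.2 (neg_le_neg (mul_le_mul_of_nonneg_right hrr (hw k l)))) hamp)
  have hw₁ : ∀ k l, 0 ≤ tdist1 Nf (locΛ k) (locΛ l) := fun k l => tdist1_nonneg _ _
  have hwX : ∀ k l, 0 ≤ distX X (locΛ k) (locΛ l) := fun k l => distX_nonneg X _ _
  set r₁ := ρ' + η with hr₁
  set r₂ := ρ' + 2 * η with hr₂
  set r₃ := ρ' + 3 * η with hr₃
  have hr₁0 : 0 ≤ r₁ := by positivity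
  have hr₂0 : 0 ≤ r₂ := by positivity
  have hr₃0 : 0 ≤ r₃ := by positivity
  have hr₃ρ : r₃ + η ≤ ρ := by simp only [hr₃]; linarith
  have hr₂r₃ : r₂ + η ≤ r₃ := by simp only [hr₂, hr₃]; linarith
  have hr₁r₂ : r₁ + η ≤ r₂ := by simp only [hr₁, hr₂]; linarith
  have hρ'r₁ : ρ' + η ≤ r₁ := by simp only [hr₁]; linarith
  have hr₁ρ : r₁ + η ≤ ρ := by simp only [hr₁]; linarith
  have le₃ : r₃ ≤ ρ := by linarith
  have le₂ : r₂ ≤ ρ := by linarith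
  have le₁ : r₁ ≤ ρ := by linarith
  have le₁₂ : r₁ ≤ r₂ := by linarith
  set g : ℝ := Real.exp (-(ρ' * distX X (locΛ i) (locΛ j))) with hg
  set Cpt : ℝ := ϱ * (16 * BE * B₀ * cV ^ 4 / m ^ 2 + 4 * DE' * cV ^ 2 / m) with hCpt
  -- the pointwise bound of the second-order difference of the integrands
  have hptw : ∀ x ∈ Ioi (0 : ℝ),
      ‖((Real.sqrt x)⁻¹ • ((x : ℂ) • (1 : Matrix Λ Λ ℂ) + PB σ)⁻¹ i j
          - (Real.sqrt x)⁻¹ • ((x : ℂ) • (1 : Matrix Λ Λ ℂ) + PB 0)⁻¹ i j)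
        - ((Real.sqrt x)⁻¹ • ((x : ℂ) • (1 : Matrix Λ Λ ℂ) + PA σ)⁻¹ i j
          - (Real.sqrt x)⁻¹ • ((x : ℂ) • (1 : Matrix Λ Λ ℂ) + PA 0)⁻¹ i j)‖
        ≤ Cpt * g * kernel m x := by
    intro x hx
    have hx0 : (0 : ℝ) < x := hx
    have hmx : 0 < m + x := by linarith
    obtain ⟨hu1, hb1⟩ := hR1 x hx0.le
    obtain ⟨hu2, hb2⟩ := hR2 x hx0.le
    obtain ⟨hu3, hb3⟩ := hR3 x hx0.le
    obtain ⟨hu4, hb4⟩ := hR4 x hx0.le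
    have hU1 : IsUnit ((x : ℂ) • (1 : Matrix Λ Λ ℂ) + PB σ) := (Matrix.isUnit_iff_isUnit_det _).2 hu1
    have hU2 : IsUnit ((x : ℂ) • (1 : Matrix Λ Λ ℂ) + PB 0) := (Matrix.isUnit_iff_isUnit_det _).2 hu2
    have hU3 : IsUnit ((x : ℂ) • (1 : Matrix Λ Λ ℂ) + PA σ) := (Matrix.isUnit_iff_isUnit_det _).2 hu3
    have hU4 : IsUnit ((x : ℂ) • (1 : Matrix Λ Λ ℂ) + PA 0) := (Matrix.isUnit_iff_isUnit_det _).2 hu4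
    set R₁ := ((x : ℂ) • (1 : Matrix Λ Λ ℂ) + PB σ)⁻¹ with hR₁def
    set R₂ := ((x : ℂ) • (1 : Matrix Λ Λ ℂ) + PB 0)⁻¹ with hR₂def
    set R₃ := ((x : ℂ) • (1 : Matrix Λ Λ ℂ) + PA σ)⁻¹ with hR₃def
    set R₄ := ((x : ℂ) • (1 : Matrix Λ Λ ℂ) + PA 0)⁻¹ with hR₄def
    set a : ℝ := 2 / (m + x) with ha
    have ha0 : 0 ≤ a := by positivity
    have ham : a ≤ 2 / m := div_le_div_of_nonneg_left zero_le_two hm (by linarith)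
    -- first-order resolvent identities
    have h12 : R₁ - R₂ = R₁ * (PB 0 - PB σ) * R₂ := by
      rw [hR₁def, hR₂def, Matrix.inv_sub_inv (iff_of_true hU1 hU2), add_sub_add_left_eq_sub]
    have h34 : R₃ - R₄ = R₃ * (PA 0 - PA σ) * R₄ := by
      rw [hR₃def, hR₄def, Matrix.inv_sub_inv (iff_of_true hU3 hU4), add_sub_add_left_eq_sub]
    have h13 : R₁ - R₃ = R₁ * (PA σ - PB σ) * R₃ := by
      rw [hR₁def, hR₃def, Matrix.inv_sub_inv (iff_of_true hU1 hU3), add_sub_add_left_eq_sub]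
    have h24 : R₂ - R₄ = R₂ * (PA 0 - PB 0) * R₄ := by
      rw [hR₂def, hR₄def, Matrix.inv_sub_inv (iff_of_true hU2 hU4), add_sub_add_left_eq_sub]
    have hsecond := resolvent_second_order h12 h34 h13 h24
    -- resolvent majorants in `d₁`-currency at rate `ρ`
    have hRd : ∀ {T : Matrix Λ Λ ℂ}, (∀ k l, ‖((x : ℂ) • (1 : Matrix Λ Λ ℂ) + T)⁻¹ k l‖ ≤ 2 / (m + x) * Real.exp (-(θ * dist k l))) →
        ∀ k l, ‖((x : ℂ) • (1 : Matrix Λ Λ ℂ) + T)⁻¹ k l‖ ≤ a * Real.exp (-(ρ * tdist1 Nf (locΛ k) (locΛ l))) :=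
      fun hT k l => (hT k l).trans (mul_le_mul_of_nonneg_left (Real.exp_le_exp.2 (neg_le_neg (hrate k l))) ha0)
    have d1 : ∀ k l, ‖R₁ k l‖ ≤ a * Real.exp (-(ρ * tdist1 Nf (locΛ k) (locΛ l))) := hRd hb1
    have d2 : ∀ k l, ‖R₂ k l‖ ≤ a * Real.exp (-(ρ * tdist1 Nf (locΛ k) (locΛ l))) := hRd hb2
    have d3 : ∀ k l, ‖R₃ k l‖ ≤ a * Real.exp (-(ρ * tdist1 Nf (locΛ k) (locΛ l))) := hRd hb3
    have d4 : ∀ k l, ‖R₄ k l‖ ≤ a * Real.exp (-(ρ * tdist1 Nf (locΛ k) (locΛ l))) := hRd hb4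
    -- the precision letters as entrywise majorants of the differenced lines
    have e31 : ∀ k l, ‖(PA σ - PB σ) k l‖ ≤ ϱ * BE * Real.exp (-(ρ * tdist1 Nf (locΛ k) (locΛ l))) := fun k l => by
      rw [Matrix.sub_apply, norm_sub_rev, mul_assoc]; exact hclose σ hσ k l
    have e42 : ∀ k l, ‖(PA 0 - PB 0) k l‖ ≤ ϱ * BE * Real.exp (-(ρ * tdist1 Nf (locΛ k) (locΛ l))) := fun k l => by
      rw [Matrix.sub_apply, norm_sub_rev, mul_assoc]; exact hclose 0 h0 k l
    have e21 : ∀ k l, ‖(PB 0 - PB σ) k l‖ ≤ B₀ * Real.exp (-(ρ * distX X (locΛ k) (locΛ l))) := fun k l => by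
      rw [Matrix.sub_apply, norm_sub_rev]; exact hB' σ hσ k l
    have e43 : ∀ k l, ‖(PA 0 - PA σ) k l‖ ≤ B₀ * Real.exp (-(ρ * distX X (locΛ k) (locΛ l))) := fun k l => by
      rw [Matrix.sub_apply, norm_sub_rev]; exact hA' σ hσ k l
    have eE : ∀ k l, ‖((PB 0 - PB σ) - (PA 0 - PA σ)) k l‖ ≤ ϱ * DE' * Real.exp (-(ρ * distX X (locΛ k) (locΛ l))) := fun k l => by
      have e : ((PB 0 - PB σ) - (PA 0 - PA σ)) k l = -((PB σ k l - PB 0 k l) - (PA σ k l - PA 0 k l)) := by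
        simp only [Matrix.sub_apply]; ring
      rw [e, norm_neg, mul_assoc]; exact hlocP σ hσ k l
    -- TERM 1: R₁ (T₃ − T₁) R₃ (T₂ − T₁) R₂
    have s1 := norm_mul_apply_le_of_decay locΛ locΛ locΛ (M₁ := R₁) (M₂ := PA σ - PB σ) (a := a) (b := ϱ * BE)
      ha0 (mul_nonneg hϱ hBE) hr₃0 hη hr₃ρ d1 e31 hvol
    have s2 := norm_mul_apply_le_of_decay locΛ locΛ locΛ (M₁ := R₁ * (PA σ - PB σ)) (M₂ := R₃) (a := a * (ϱ * BE) * cV) (b := a)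
      (by positivity) ha0 hr₂0 hη hr₂r₃ s1 (wk ha0 le₃ hw₁ d3) hvol
    have s3 := norm_mul_apply_le_of_decayX_right locΛ locΛ locΛ hX (M₁ := R₁ * (PA σ - PB σ) * R₃) (M₂ := PB 0 - PB σ)
      (a := a * (ϱ * BE) * cV * a * cV) (b := B₀) (by positivity) hB₀ hr₁0 hη hr₁r₂ s2 (wk hB₀ le₂ hwX e21) hvol
    have s4 := norm_mul_apply_le_of_decayX_left locΛ locΛ locΛ hX (M₁ := R₁ * (PA σ - PB σ) * R₃ * (PB 0 - PB σ)) (M₂ := R₂)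
      (a := a * (ϱ * BE) * cV * a * cV * B₀ * cV) (b := a) (by positivity) ha0 hρ' hη hρ'r₁ s3 (wk ha0 le₁ hw₁ d2) hvol' i j
    -- TERM 2: R₃ ((T₂ − T₁) − (T₄ − T₃)) R₂
    have v1 := norm_mul_apply_le_of_decayX_right locΛ locΛ locΛ hX (M₁ := R₃) (M₂ := (PB 0 - PB σ) - (PA 0 - PA σ))
      (a := a) (b := ϱ * DE') ha0 (mul_nonneg hϱ hDE') hr₁0 hη hr₁ρ d3 eE hvol
    have v2 := norm_mul_apply_le_of_decayX_left locΛ locΛ locΛ hX (M₁ := R₃ * ((PB 0 - PB σ) - (PA 0 - PA σ))) (M₂ := R₂)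
      (a := a * (ϱ * DE') * cV) (b := a) (by positivity) ha0 hρ' hη hρ'r₁ v1 (wk ha0 le₁ hw₁ d2) hvol' i j
    -- TERM 3: R₃ (T₄ − T₃) (R₂ (T₄ − T₂) R₄)
    have u1 := norm_mul_apply_le_of_decay locΛ locΛ locΛ (M₁ := R₂) (M₂ := PA 0 - PB 0) (a := a) (b := ϱ * BE)
      ha0 (mul_nonneg hϱ hBE) hr₃0 hη hr₃ρ d2 e42 hvol
    have u2 := norm_mul_apply_le_of_decay locΛ locΛ locΛ (M₁ := R₂ * (PA 0 - PB 0)) (M₂ := R₄) (a := a * (ϱ * BE) * cV) (b := a)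
      (by positivity) ha0 hr₂0 hη hr₂r₃ u1 (wk ha0 le₃ hw₁ d4) hvol
    have u3 := norm_mul_apply_le_of_decayX_right locΛ locΛ locΛ hX (M₁ := R₃) (M₂ := PA 0 - PA σ)
      (a := a) (b := B₀) ha0 hB₀ hr₁0 hη hr₁r₂ (wk ha0 le₂ hw₁ d3) (wk hB₀ le₂ hwX e43) hvol
    have u4 := norm_mul_apply_le_of_decayX_left locΛ locΛ locΛ hX (M₁ := R₃ * (PA 0 - PA σ)) (M₂ := R₂ * (PA 0 - PB 0) * R₄)
      (a := a * B₀ * cV) (b := a * (ϱ * BE) * cV * a * cV) (by positivity) (by positivity) hρ' hη hρ'r₁ u3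
      (wk (by positivity) le₁₂ hw₁ u2) hvol' i j
    -- assemble the three terms
    have hnorm : ‖((R₁ - R₂) - (R₃ - R₄)) i j‖ ≤ (a ^ 3 * (2 * ϱ * BE * B₀ * cV ^ 4) + a ^ 2 * (ϱ * DE' * cV ^ 2)) * g := by
      rw [hsecond, Matrix.add_apply, Matrix.add_apply]
      calc ‖(R₁ * (PA σ - PB σ) * R₃ * (PB 0 - PB σ) * R₂) i j + (R₃ * ((PB 0 - PB σ) - (PA 0 - PA σ)) * R₂) i j
            + (R₃ * (PA 0 - PA σ) * (R₂ * (PA 0 - PB 0) * R₄)) i j‖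
          ≤ ‖(R₁ * (PA σ - PB σ) * R₃ * (PB 0 - PB σ) * R₂) i j‖ + ‖(R₃ * ((PB 0 - PB σ) - (PA 0 - PA σ)) * R₂) i j‖
            + ‖(R₃ * (PA 0 - PA σ) * (R₂ * (PA 0 - PB 0) * R₄)) i j‖ := (norm_add_le _ _).trans (add_le_add (norm_add_le _ _) le_rfl)
        _ ≤ a * (ϱ * BE) * cV * a * cV * B₀ * cV * a * cV * g + a * (ϱ * DE') * cV * a * cV * g
            + a * B₀ * cV * (a * (ϱ * BE) * cV * a * cV) * cV * g := add_le_add (add_le_add s4 v2) u4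
        _ = (a ^ 3 * (2 * ϱ * BE * B₀ * cV ^ 4) + a ^ 2 * (ϱ * DE' * cV ^ 2)) * g := by ring
    have ha3 : a ^ 3 ≤ a * (2 / m) ^ 2 := by
      have : a ^ 2 ≤ (2 / m) ^ 2 := pow_le_pow_left₀ ha0 ham 2
      calc a ^ 3 = a * a ^ 2 := by ring
        _ ≤ a * (2 / m) ^ 2 := mul_le_mul_of_nonneg_left this ha0
    have ha2 : a ^ 2 ≤ a * (2 / m) := by
      calc a ^ 2 = a * a := by ring
        _ ≤ a * (2 / m) := mul_le_mul_of_nonneg_left ham ha0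
    have hg0 : 0 ≤ g := (Real.exp_pos _).le
    have hnorm' : ‖((R₁ - R₂) - (R₃ - R₄)) i j‖ ≤ a * (ϱ * (8 * BE * B₀ * cV ^ 4 / m ^ 2 + 2 * DE' * cV ^ 2 / m)) * g := by
      refine hnorm.trans ?_
      have h1 : a ^ 3 * (2 * ϱ * BE * B₀ * cV ^ 4) ≤ a * (2 / m) ^ 2 * (2 * ϱ * BE * B₀ * cV ^ 4) :=
        mul_le_mul_of_nonneg_right ha3 (by positivity)
      have h2 : a ^ 2 * (ϱ * DE' * cV ^ 2) ≤ a * (2 / m) * (ϱ * DE' * cV ^ 2) := mul_le_mul_of_nonneg_right ha2 (by positivity)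
      calc (a ^ 3 * (2 * ϱ * BE * B₀ * cV ^ 4) + a ^ 2 * (ϱ * DE' * cV ^ 2)) * g
          ≤ (a * (2 / m) ^ 2 * (2 * ϱ * BE * B₀ * cV ^ 4) + a * (2 / m) * (ϱ * DE' * cV ^ 2)) * g :=
            mul_le_mul_of_nonneg_right (add_le_add h1 h2) hg0
        _ = a * (ϱ * (8 * BE * B₀ * cV ^ 4 / m ^ 2 + 2 * DE' * cV ^ 2 / m)) * g := by
            have hm0 : m ≠ 0 := hm.ne'
            field_simp
            ring
    -- the integrand
    rw [← smul_sub, ← smul_sub, ← smul_sub, ← Matrix.sub_apply, ← Matrix.sub_apply, ← Matrix.sub_apply, norm_smul, Real.norm_eq_abs,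
      abs_of_nonneg (inv_nonneg.2 (Real.sqrt_nonneg x)), kernel]
    have hsx : 0 ≤ (Real.sqrt x)⁻¹ := inv_nonneg.2 (Real.sqrt_nonneg x)
    calc (Real.sqrt x)⁻¹ * ‖((R₁ - R₂) - (R₃ - R₄)) i j‖
        ≤ (Real.sqrt x)⁻¹ * (a * (ϱ * (8 * BE * B₀ * cV ^ 4 / m ^ 2 + 2 * DE' * cV ^ 2 / m)) * g) :=
          mul_le_mul_of_nonneg_left hnorm' hsx
      _ = Cpt * g * ((Real.sqrt x)⁻¹ * (x + m)⁻¹) := by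
          simp only [hCpt, ha]
          rw [add_comm m x]
          have hxm : x + m ≠ 0 := by linarith
          field_simp
          ring
  -- integrate
  have hbound := norm_integral_le_of_norm_le ((integrableOn_kernel_Ioi hm).const_mul (Cpt * g))
    (ae_restrict_of_forall_mem measurableSet_Ioi hptw)
  rw [integral_const_mul, integral_kernel_Ioi hm] at hbound
  have eall := integral_sub (hI1.sub hI2) (hI3.sub hI4)
  simp only [Pi.sub_apply] at eall
  rw [integral_sub hI1 hI2, integral_sub hI3 hI4] at eall
  rw [invSqrt_apply, invSqrt_apply, invSqrt_apply, invSqrt_apply, ← smul_sub, ← smul_sub, ← smul_sub, ← eall,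
    norm_smul, Real.norm_eq_abs, abs_of_pos (inv_pos.2 Real.pi_pos)]
  refine (mul_le_mul_of_nonneg_left hbound (inv_pos.2 Real.pi_pos).le).trans_eq ?_
  simp only [hCpt]
  have hπ0 : Real.pi ≠ 0 := Real.pi_ne_zero
  have hm0 : m ≠ 0 := hm.ne'
  have hsm : Real.sqrt m ≠ 0 := (Real.sqrt_pos.2 hm).ne'
  field_simp

end SqrtLoc

end Summit.QuantumFields.YangMills.BalabanUVNodes.N18TwoRunLettersCalculusSqrtLoc

end
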